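import Mathlib

/-!
# Route `FilamentSkeletonRss` · crux `SkeletonJ1G` (27849) · child `TangentSkeletonNearStraight` (28295) ·
# line `child_tangent_analytic_strip` · toward stub P3 `stub_liaSymbol` — THE POSITIVE-VARIABLE REPRESENTATION
# `𝔖(x) = ∫₀^∞ e^{−t}·(1 − (1 + x²/(2t))·e^{−x²/(4t)}) dt`

Lane ns-filament-19175-p1 g12 (prover), 2026-08-28, `--supports stmt-NavierStokesRegularity-28295`.

The line's symbol `𝔖(x) = ∫₀^∞ (1 − cos(xh) − xh·sin(xh))·(1+h²)^{-3/2} dh` (`= 1 − xK₁(x) − x²K₀(x)`) is an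
OSCILLATORY integral; every bound of `LiaSymbolBound` is proved from the representation above, whose integrand has the
sign of `1 − (1+2y)e^{−y}`, `y = x²/(4t)`.  Proof: Γ(3/2)-subordination `(1+h²)^{-3/2} = Γ(3/2)⁻¹ ∫₀^∞ √t·e^{−(1+h²)t} dt`,
Fubini, and the half-line Gaussian integrals `∫₀^∞ e^{−th²} = ½√(π/t)`, `∫₀^∞ cos(xh)e^{−th²} = ½√(π/t)·e^{−x²/(4t)}`
(real part of `integral_cexp_quadratic`), `∫₀^∞ (x·cos(xh) − 2t·h·sin(xh))·e^{−th²} dh = 0` (exact derivative).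
Stated def-free (explicit integrals) so that it is a pure proof file; the vocabulary file
`FilamentSkeletonRssAnalyticStripLiaSymbolDefs` names the left side `liaSym`.

HONEST FRAMING: a lemma about one explicit real integral, serving a HYPOTHETICAL filament-skeleton line on the NEGATIVE
side of a MODEL route.  Nothing here bears on Navier–Stokes regularity or blow-up.
-/

set_option linter.dupNamespace false

noncomputable section

namespace Summit.NavierStokesRegularity.NavierStokesRegularity.Theorems.AnalyticStripLiaSymbol

open Real Set MeasureTheory Filter Topology Complex

/-! ## §1  Half-line Gaussian integrals -/

/-- `∫_ℝ cos(xh)·e^{−th²} dh = √(π/t)·e^{−x²/(4t)}` (real part of the complex Gaussian integral). -/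
theorem integral_cos_mul_exp_neg_mul_sq {t : ℝ} (ht : 0 < t) (x : ℝ) :
    ∫ h : ℝ, Real.cos (x * h) * Real.exp (-t * h ^ 2) = √(π / t) * Real.exp (-x ^ 2 / (4 * t)) := by
  have hb : (-(t : ℂ)).re < 0 := by simp [ht]
  have key := integral_cexp_quadratic hb (I * x) 0
  have hint : Integrable (fun h : ℝ => cexp (-(t : ℂ) * (h : ℂ) ^ 2 + I * x * h + 0)) :=
    integrable_cexp_quadratic' hb _ _
  -- real parts of the integrand
  have hre : ∀ h : ℝ, (cexp (-(t : ℂ) * (h : ℂ) ^ 2 + I * x * h + 0)).re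
      = Real.cos (x * h) * Real.exp (-t * h ^ 2) := by
    intro h
    rw [Complex.exp_re]
    have h1 : (-(t : ℂ) * (h : ℂ) ^ 2 + I * x * h + 0).re = -t * h ^ 2 := by
      simp [pow_two]
    have h2 : (-(t : ℂ) * (h : ℂ) ^ 2 + I * x * h + 0).im = x * h := by
      simp [pow_two]
    rw [h1, h2, mul_comm]
  -- real part of the right-hand side
  have hrhs : ((π / -(-(t : ℂ))) ^ (1 / 2 : ℂ) * cexp (0 - (I * x) ^ 2 / (4 * -(t : ℂ)))).re
      = √(π / t) * Real.exp (-x ^ 2 / (4 * t)) := by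
    have e1 : (π / -(-(t : ℂ))) ^ (1 / 2 : ℂ) = ((√(π / t) : ℝ) : ℂ) := by
      rw [neg_neg, Real.sqrt_eq_rpow, Complex.ofReal_cpow (by positivity)]
      push_cast
      norm_num
    have e2 : cexp (0 - (I * x) ^ 2 / (4 * -(t : ℂ))) = ((Real.exp (-x ^ 2 / (4 * t)) : ℝ) : ℂ) := by
      rw [Complex.ofReal_exp]
      congr 1
      have ht' : (t : ℂ) ≠ 0 := by exact_mod_cast ht.ne'
      push_cast
      field_simp
      rw [I_sq]
      ring
    rw [e1, e2, ← Complex.ofReal_mul, Complex.ofReal_re]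
  calc ∫ h : ℝ, Real.cos (x * h) * Real.exp (-t * h ^ 2)
      = ∫ h : ℝ, (cexp (-(t : ℂ) * (h : ℂ) ^ 2 + I * x * h + 0)).re := by
        refine integral_congr_ae (Filter.Eventually.of_forall fun h => (hre h).symm)
    _ = (∫ h : ℝ, cexp (-(t : ℂ) * (h : ℂ) ^ 2 + I * x * h + 0)).re := by
        have := integral_re hint
        simpa using this
    _ = √(π / t) * Real.exp (-x ^ 2 / (4 * t)) := by rw [key, hrhs]


/-- Half-line version: `∫₀^∞ cos(xh)·e^{−th²} dh = ½√(π/t)·e^{−x²/(4t)}` (evenness). -/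
theorem integral_Ioi_cos_mul_exp_neg_mul_sq {t : ℝ} (ht : 0 < t) (x : ℝ) :
    ∫ h in Ioi (0:ℝ), Real.cos (x * h) * Real.exp (-t * h ^ 2)
      = √(π / t) / 2 * Real.exp (-x ^ 2 / (4 * t)) := by
  have heven : ∫ h : ℝ, (fun u => Real.cos (x * u) * Real.exp (-t * u ^ 2)) |h|
      = 2 * ∫ h in Ioi (0:ℝ), Real.cos (x * h) * Real.exp (-t * h ^ 2) :=
    integral_comp_abs (f := fun u => Real.cos (x * u) * Real.exp (-t * u ^ 2))
  have habs : ∀ h : ℝ, (fun u => Real.cos (x * u) * Real.exp (-t * u ^ 2)) |h|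
      = Real.cos (x * h) * Real.exp (-t * h ^ 2) := by
    intro h
    simp only [sq_abs]
    rcases le_or_gt 0 h with hh | hh
    · rw [abs_of_nonneg hh]
    · rw [abs_of_neg hh, mul_neg, Real.cos_neg]
  simp_rw [habs] at heven
  rw [integral_cos_mul_exp_neg_mul_sq ht x] at heven
  linarith

/-- The exact-derivative integral: `∫₀^∞ (x·cos(xh) − 2t·h·sin(xh))·e^{−th²} dh = 0`
(the integrand is `d/dh [sin(xh)·e^{−th²}]`, which vanishes at `0` and at `∞`). -/
theorem integral_Ioi_deriv_sin_mul_exp {t : ℝ} (ht : 0 < t) (x : ℝ) :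
    ∫ h in Ioi (0:ℝ), (x * Real.cos (x * h) - 2 * t * h * Real.sin (x * h)) * Real.exp (-t * h ^ 2) = 0 := by
  have hderiv : ∀ h ∈ Ioi (0:ℝ), HasDerivAt (fun u : ℝ => Real.sin (x * u) * Real.exp (-t * u ^ 2))
      ((x * Real.cos (x * h) - 2 * t * h * Real.sin (x * h)) * Real.exp (-t * h ^ 2)) h := by
    intro h _
    have h1 : HasDerivAt (fun u : ℝ => Real.sin (x * u)) (Real.cos (x * h) * x) h := by
      have := ((hasDerivAt_id h).const_mul x).sin
      simpa using this
    have h2 : HasDerivAt (fun u : ℝ => Real.exp (-t * u ^ 2)) (Real.exp (-t * h ^ 2) * (-t * (2 * h))) h := by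
      have : HasDerivAt (fun u : ℝ => -t * u ^ 2) (-t * (2 * h)) h := by
        simpa using ((hasDerivAt_pow 2 h).const_mul (-t))
      exact (Real.hasDerivAt_exp _).comp h this
    have h3 : HasDerivAt (fun u : ℝ => Real.sin (x * u) * Real.exp (-t * u ^ 2))
        (Real.cos (x * h) * x * Real.exp (-t * h ^ 2)
          + Real.sin (x * h) * (Real.exp (-t * h ^ 2) * (-t * (2 * h)))) h := h1.mul h2
    refine h3.congr_deriv ?_
    ring
  -- integrability of the derivative
  have hint : IntegrableOn (fun h : ℝ => (x * Real.cos (x * h) - 2 * t * h * Real.sin (x * h))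
      * Real.exp (-t * h ^ 2)) (Ioi 0) := by
    have hA : Integrable (fun h : ℝ => x * (Real.cos (x * h) * Real.exp (-t * h ^ 2))) := by
      refine Integrable.const_mul ?_ x
      refine (integrable_exp_neg_mul_sq ht).bdd_mul (c := 1) ?_ ?_
      · exact (Real.continuous_cos.comp (continuous_const.mul continuous_id)).aestronglyMeasurable
      · exact Filter.Eventually.of_forall fun h => by
          simpa using Real.abs_cos_le_one (x * h)
    have hB : Integrable (fun h : ℝ => (2 * t) * (Real.sin (x * h) * (h * Real.exp (-t * h ^ 2)))) := by
      refine Integrable.const_mul ?_ (2 * t)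
      refine (integrable_mul_exp_neg_mul_sq ht).bdd_mul (c := 1) ?_ ?_
      · exact (Real.continuous_sin.comp (continuous_const.mul continuous_id)).aestronglyMeasurable
      · exact Filter.Eventually.of_forall fun h => by
          simpa using Real.abs_sin_le_one (x * h)
    have := (hA.sub hB).integrableOn (s := Ioi (0:ℝ))
    refine this.congr_fun (fun h _ => ?_) measurableSet_Ioi
    simp only [Pi.sub_apply]
    ring
  -- limit at infinity
  have hlim : Tendsto (fun u : ℝ => Real.sin (x * u) * Real.exp (-t * u ^ 2)) atTop (𝓝 0) := by
    have h0 : Tendsto (fun u : ℝ => Real.exp (-t * u ^ 2)) atTop (𝓝 0) := by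
      have : Tendsto (fun u : ℝ => -t * u ^ 2) atTop atBot := by
        have h' : Tendsto (fun u : ℝ => u ^ 2) atTop atTop := tendsto_pow_atTop two_ne_zero
        exact h'.const_mul_atTop_of_neg (by linarith)
      exact Real.tendsto_exp_atBot.comp this
    refine squeeze_zero_norm (fun u => ?_) h0
    rw [norm_mul, Real.norm_eq_abs, Real.norm_eq_abs, abs_of_pos (Real.exp_pos _)]
    calc |Real.sin (x * u)| * Real.exp (-t * u ^ 2) ≤ 1 * Real.exp (-t * u ^ 2) := by
          gcongr; exact Real.abs_sin_le_one _
      _ = Real.exp (-t * u ^ 2) := one_mul _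
  have hcont : ContinuousWithinAt (fun u : ℝ => Real.sin (x * u) * Real.exp (-t * u ^ 2)) (Ici 0) 0 :=
    ((Real.continuous_sin.comp (continuous_const.mul continuous_id)).mul
      (Real.continuous_exp.comp (continuous_const.mul (continuous_pow 2)))).continuousWithinAt
  have := integral_Ioi_of_hasDerivAt_of_tendsto hcont hderiv hint hlim
  simpa using this

/-- THE INNER INTEGRAL: for `t > 0`,
`∫₀^∞ (1 − cos(xh) − xh·sin(xh))·e^{−th²} dh = ½√(π/t)·(1 − (1 + x²/(2t))·e^{−x²/(4t)})`. -/
theorem integral_Ioi_liaIntegrand_mul_exp {t : ℝ} (ht : 0 < t) (x : ℝ) :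
    ∫ h in Ioi (0:ℝ), (1 - Real.cos (x * h) - x * h * Real.sin (x * h)) * Real.exp (-t * h ^ 2)
      = √(π / t) / 2 * (1 - (1 + x ^ 2 / (2 * t)) * Real.exp (-x ^ 2 / (4 * t))) := by
  -- pointwise decomposition of the integrand
  have hdec : ∀ h : ℝ, (1 - Real.cos (x * h) - x * h * Real.sin (x * h)) * Real.exp (-t * h ^ 2)
      = Real.exp (-t * h ^ 2) - (1 + x ^ 2 / (2 * t)) * (Real.cos (x * h) * Real.exp (-t * h ^ 2))
        + x / (2 * t) * ((x * Real.cos (x * h) - 2 * t * h * Real.sin (x * h)) * Real.exp (-t * h ^ 2)) := by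
    intro h
    field_simp
    ring
  have hI0 : IntegrableOn (fun h : ℝ => Real.exp (-t * h ^ 2)) (Ioi 0) :=
    (integrable_exp_neg_mul_sq ht).integrableOn
  have hIc : IntegrableOn (fun h : ℝ => Real.cos (x * h) * Real.exp (-t * h ^ 2)) (Ioi 0) := by
    refine ((integrable_exp_neg_mul_sq ht).bdd_mul (c := 1) ?_ ?_).integrableOn
    · exact (Real.continuous_cos.comp (continuous_const.mul continuous_id)).aestronglyMeasurable
    · exact Filter.Eventually.of_forall fun h => by simpa using Real.abs_cos_le_one (x * h)
  have hId : IntegrableOn (fun h : ℝ => (x * Real.cos (x * h) - 2 * t * h * Real.sin (x * h))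
      * Real.exp (-t * h ^ 2)) (Ioi 0) := by
    have hA : Integrable (fun h : ℝ => x * (Real.cos (x * h) * Real.exp (-t * h ^ 2))) := by
      refine Integrable.const_mul ?_ x
      refine (integrable_exp_neg_mul_sq ht).bdd_mul (c := 1) ?_ ?_
      · exact (Real.continuous_cos.comp (continuous_const.mul continuous_id)).aestronglyMeasurable
      · exact Filter.Eventually.of_forall fun h => by simpa using Real.abs_cos_le_one (x * h)
    have hB : Integrable (fun h : ℝ => (2 * t) * (Real.sin (x * h) * (h * Real.exp (-t * h ^ 2)))) := by
      refine Integrable.const_mul ?_ (2 * t)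
      refine (integrable_mul_exp_neg_mul_sq ht).bdd_mul (c := 1) ?_ ?_
      · exact (Real.continuous_sin.comp (continuous_const.mul continuous_id)).aestronglyMeasurable
      · exact Filter.Eventually.of_forall fun h => by simpa using Real.abs_sin_le_one (x * h)
    have := (hA.sub hB).integrableOn (s := Ioi (0:ℝ))
    refine this.congr_fun (fun h _ => ?_) measurableSet_Ioi
    simp only [Pi.sub_apply]
    ring
  have hI1 : IntegrableOn (fun h : ℝ => (1 + x ^ 2 / (2 * t)) * (Real.cos (x * h) * Real.exp (-t * h ^ 2))) (Ioi 0) :=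
    hIc.const_mul _
  have hI2 : IntegrableOn (fun h : ℝ => x / (2 * t) * ((x * Real.cos (x * h) - 2 * t * h * Real.sin (x * h))
      * Real.exp (-t * h ^ 2))) (Ioi 0) := hId.const_mul _
  have hI01 : IntegrableOn (fun h : ℝ => Real.exp (-t * h ^ 2)
      - (1 + x ^ 2 / (2 * t)) * (Real.cos (x * h) * Real.exp (-t * h ^ 2))) (Ioi 0) := hI0.sub hI1
  simp_rw [hdec]
  rw [integral_add hI01 hI2, integral_sub hI0 hI1, integral_const_mul, integral_const_mul,
    integral_gaussian_Ioi t, integral_Ioi_cos_mul_exp_neg_mul_sq ht x, integral_Ioi_deriv_sin_mul_exp ht x]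
  ring


/-! ## §2  Γ(3/2)-subordination of the algebraic kernel -/

/-- `Γ(3/2) = √π/2`. -/
theorem Gamma_three_halves : Real.Gamma (3 / 2) = √π / 2 := by
  have h := Real.Gamma_add_one (s := 1 / 2) (by norm_num)
  rw [show (1:ℝ) / 2 + 1 = 3 / 2 by norm_num, Real.Gamma_one_half_eq] at h
  rw [h]; ring

/-- SUBORDINATION: `((1+h²)^{3/2})⁻¹ = Γ(3/2)⁻¹ · ∫₀^∞ t^{1/2} e^{−(1+h²)t} dt`. -/
theorem inv_rpow_three_halves_eq_integral (h : ℝ) :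
    ((1 + h ^ 2) ^ (3 / 2 : ℝ))⁻¹
      = (Real.Gamma (3 / 2))⁻¹ * ∫ t in Ioi (0:ℝ), t ^ (1 / 2 : ℝ) * Real.exp (-((1 + h ^ 2) * t)) := by
  have hr : 0 < 1 + h ^ 2 := by positivity
  have key := Real.integral_rpow_mul_exp_neg_mul_Ioi (a := 3 / 2) (r := 1 + h ^ 2) (by norm_num) hr
  rw [show (3:ℝ) / 2 - 1 = 1 / 2 by norm_num] at key
  rw [key, one_div, Real.inv_rpow hr.le]
  have hG : Real.Gamma (3 / 2) ≠ 0 := (Real.Gamma_pos_of_pos (by norm_num)).ne'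
  field_simp

/-- Integrability of the subordination density `t^{1/2} e^{−(1+h²)t}` on `(0, ∞)`. -/
theorem integrableOn_rpow_half_mul_exp (h : ℝ) :
    IntegrableOn (fun t : ℝ => t ^ (1 / 2 : ℝ) * Real.exp (-((1 + h ^ 2) * t))) (Ioi 0) := by
  have hr : 0 < 1 + h ^ 2 := by positivity
  have := integrableOn_rpow_mul_exp_neg_mul_rpow (s := 1 / 2) (p := 1) (b := 1 + h ^ 2)
    (by norm_num) le_rfl hr
  refine this.congr_fun (fun t ht => ?_) measurableSet_Ioi
  simp only [Real.rpow_one, neg_mul]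

/-! ## §3  Fubini -/

/-- Continuity of the two-variable integrand of the subordinated symbol (no `def`: this file stays a pure
proof file; the integrand is written out). -/
theorem continuous_subordinand (x : ℝ) : Continuous (fun p : ℝ × ℝ => (1 - Real.cos (x * p.1) - x * p.1 * Real.sin (x * p.1))
    * ((Real.Gamma (3 / 2))⁻¹ * (p.2 ^ (1 / 2 : ℝ) * Real.exp (-((1 + p.1 ^ 2) * p.2))))) := by
  have hr : Continuous fun p : ℝ × ℝ => p.2 ^ (1 / 2 : ℝ) :=
    (Real.continuous_rpow_const (by norm_num)).comp continuous_snd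
  fun_prop

/-- The oscillatory factor is bounded by `2 + |x|·h` for `h ≥ 0`. -/
theorem abs_liaIntegrand_le {x h : ℝ} (hh : 0 ≤ h) :
    |1 - Real.cos (x * h) - x * h * Real.sin (x * h)| ≤ 2 + |x| * h := by
  have h1 : |1 - Real.cos (x * h)| ≤ 2 := by
    have := Real.abs_cos_le_one (x * h)
    rw [abs_le] at this ⊢; constructor <;> linarith [this.1, this.2]
  have h2 : |x * h * Real.sin (x * h)| ≤ |x| * h := by
    rw [abs_mul, abs_mul, abs_of_nonneg hh]
    calc |x| * h * |Real.sin (x * h)| ≤ |x| * h * 1 := by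
          gcongr; exact Real.abs_sin_le_one _
      _ = |x| * h := mul_one _
  calc |1 - Real.cos (x * h) - x * h * Real.sin (x * h)|
      ≤ |1 - Real.cos (x * h)| + |x * h * Real.sin (x * h)| := abs_sub _ _
    _ ≤ 2 + |x| * h := add_le_add h1 h2

/-- The dominating function `(2 + |x|)·(1+h²)⁻¹` is integrable, and dominates `(2 + |x| h)(1+h²)^{-3/2}` on `h ≥ 0`. -/
theorem kernel_bound {x h : ℝ} (hh : 0 ≤ h) :
    (2 + |x| * h) * ((1 + h ^ 2) ^ (3 / 2 : ℝ))⁻¹ ≤ (2 + |x|) * (1 + h ^ 2)⁻¹ := by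
  have h1 : 1 ≤ 1 + h ^ 2 := by nlinarith
  have hpos : 0 < 1 + h ^ 2 := by positivity
  -- (1+h²)^{3/2} = (1+h²) * √(1+h²)
  have hsplit : (1 + h ^ 2) ^ (3 / 2 : ℝ) = (1 + h ^ 2) * √(1 + h ^ 2) := by
    rw [show (3:ℝ) / 2 = 1 + 1 / 2 by norm_num, Real.rpow_add hpos, Real.rpow_one, Real.sqrt_eq_rpow]
  have hsq : 1 ≤ √(1 + h ^ 2) := by
    have := Real.sqrt_le_sqrt h1
    rwa [Real.sqrt_one] at this
  have hh' : h ≤ √(1 + h ^ 2) := by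
    have := Real.sqrt_le_sqrt (show h ^ 2 ≤ 1 + h ^ 2 by nlinarith)
    rwa [Real.sqrt_sq hh] at this
  rw [hsplit, mul_inv]
  have hs0 : 0 < √(1 + h ^ 2) := by positivity
  -- (2 + |x| h)/√(1+h²) ≤ 2 + |x|
  have : (2 + |x| * h) * (√(1 + h ^ 2))⁻¹ ≤ 2 + |x| := by
    rw [mul_inv_le_iff₀ hs0]
    have hx : 0 ≤ |x| := abs_nonneg x
    nlinarith [mul_le_mul_of_nonneg_left hh' hx, mul_le_mul_of_nonneg_left hsq (by norm_num : (0:ℝ) ≤ 2)]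
  calc (2 + |x| * h) * ((1 + h ^ 2)⁻¹ * (√(1 + h ^ 2))⁻¹)
      = ((2 + |x| * h) * (√(1 + h ^ 2))⁻¹) * (1 + h ^ 2)⁻¹ := by ring
    _ ≤ (2 + |x|) * (1 + h ^ 2)⁻¹ := by
        gcongr

/-- Integrability of the two-variable integrand on `(0,∞) × (0,∞)` (Tonelli on the norm: the `t`-integral of the
norm is `|1 − cos(xh) − xh sin(xh)|·(1+h²)^{−3/2} ≤ (2+|x|)(1+h²)⁻¹`). -/
theorem integrable_subordinand (x : ℝ) :
    Integrable (fun p : ℝ × ℝ => (1 - Real.cos (x * p.1) - x * p.1 * Real.sin (x * p.1))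
    * ((Real.Gamma (3 / 2))⁻¹ * (p.2 ^ (1 / 2 : ℝ) * Real.exp (-((1 + p.1 ^ 2) * p.2)))))
      ((volume.restrict (Ioi (0:ℝ))).prod (volume.restrict (Ioi (0:ℝ)))) := by
  have hmeas : AEStronglyMeasurable (fun p : ℝ × ℝ => (1 - Real.cos (x * p.1) - x * p.1 * Real.sin (x * p.1))
    * ((Real.Gamma (3 / 2))⁻¹ * (p.2 ^ (1 / 2 : ℝ) * Real.exp (-((1 + p.1 ^ 2) * p.2)))))
      ((volume.restrict (Ioi (0:ℝ))).prod (volume.restrict (Ioi (0:ℝ)))) :=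
    (continuous_subordinand x).aestronglyMeasurable
  rw [integrable_prod_iff hmeas]
  constructor
  · -- each slice is integrable
    refine Filter.Eventually.of_forall fun h => ?_
    have := ((integrableOn_rpow_half_mul_exp h).const_mul ((Real.Gamma (3 / 2))⁻¹)).const_mul
      (1 - Real.cos (x * h) - x * h * Real.sin (x * h))
    exact this
  · -- the norm integral is `|φ(xh)|·((1+h²)^{3/2})⁻¹`, integrable on `(0,∞)`
    have hnorm : ∀ h : ℝ, ∫ t in Ioi (0:ℝ), ‖(fun p : ℝ × ℝ => (1 - Real.cos (x * p.1) - x * p.1 * Real.sin (x * p.1))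
    * ((Real.Gamma (3 / 2))⁻¹ * (p.2 ^ (1 / 2 : ℝ) * Real.exp (-((1 + p.1 ^ 2) * p.2))))) (h, t)‖
        = |1 - Real.cos (x * h) - x * h * Real.sin (x * h)| * ((1 + h ^ 2) ^ (3 / 2 : ℝ))⁻¹ := by
      intro h
      have hG : 0 < (Real.Gamma (3 / 2))⁻¹ := inv_pos.mpr (Real.Gamma_pos_of_pos (by norm_num))
      have hpt : ∀ t ∈ Ioi (0:ℝ), ‖(fun p : ℝ × ℝ => (1 - Real.cos (x * p.1) - x * p.1 * Real.sin (x * p.1))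
    * ((Real.Gamma (3 / 2))⁻¹ * (p.2 ^ (1 / 2 : ℝ) * Real.exp (-((1 + p.1 ^ 2) * p.2))))) (h, t)‖ = |1 - Real.cos (x * h) - x * h * Real.sin (x * h)|
          * ((Real.Gamma (3 / 2))⁻¹ * (t ^ (1 / 2 : ℝ) * Real.exp (-((1 + h ^ 2) * t)))) := by
        intro t ht
        simp only [Real.norm_eq_abs, abs_mul]
        rw [abs_of_pos hG, abs_of_nonneg (Real.rpow_nonneg (le_of_lt ht) _), abs_of_pos (Real.exp_pos _)]
      rw [setIntegral_congr_fun measurableSet_Ioi hpt, integral_const_mul, integral_const_mul,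
        inv_rpow_three_halves_eq_integral h]
    simp_rw [hnorm]
    have hdom : Integrable (fun h : ℝ => (2 + |x|) * (1 + h ^ 2)⁻¹) (volume.restrict (Ioi (0:ℝ))) :=
      (integrable_inv_one_add_sq.const_mul _).integrableOn
    refine hdom.mono' ?_ ?_
    · refine ((Continuous.abs ?_).mul ?_).aestronglyMeasurable
      · exact (continuous_const.sub (Real.continuous_cos.comp (continuous_const.mul continuous_id))).sub
          ((continuous_const.mul continuous_id).mul (Real.continuous_sin.comp (continuous_const.mul continuous_id)))
      · refine Continuous.inv₀ ?_ (fun h => (Real.rpow_pos_of_pos (by positivity) _).ne')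
        exact (continuous_const.add (continuous_pow 2)).rpow_const fun _ => Or.inr (by norm_num)
    · rw [ae_restrict_iff' measurableSet_Ioi]
      refine Filter.Eventually.of_forall fun h hh => ?_
      have hh' : 0 ≤ h := le_of_lt hh
      rw [Real.norm_eq_abs, abs_mul, abs_abs, abs_of_pos (inv_pos.mpr (Real.rpow_pos_of_pos (by positivity) _))]
      calc |1 - Real.cos (x * h) - x * h * Real.sin (x * h)| * ((1 + h ^ 2) ^ (3 / 2 : ℝ))⁻¹
          ≤ (2 + |x| * h) * ((1 + h ^ 2) ^ (3 / 2 : ℝ))⁻¹ := by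
            gcongr; exact abs_liaIntegrand_le hh'
        _ ≤ (2 + |x|) * (1 + h ^ 2)⁻¹ := kernel_bound hh'

/-- **THE POSITIVE-VARIABLE REPRESENTATION** of the exact static self-induction symbol:
`∫₀^∞ (1 − cos(xh) − xh·sin(xh))·(1+h²)^{−3/2} dh = ∫₀^∞ e^{−t}·(1 − (1 + x²/(2t))·e^{−x²/(4t)}) dt`
for every real `x` (the left side is `liaSym x` of the vocabulary file). -/
theorem liaSym_integral_eq_laplace (x : ℝ) :
    ∫ h in Ioi (0:ℝ), (1 - Real.cos (x * h) - x * h * Real.sin (x * h)) * ((1 + h ^ 2) ^ (3 / 2 : ℝ))⁻¹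
      = ∫ t in Ioi (0:ℝ), Real.exp (-t) * (1 - (1 + x ^ 2 / (2 * t)) * Real.exp (-x ^ 2 / (4 * t))) := by
  -- left side = ∫_h ∫_t (subordinand)
  have hL : ∫ h in Ioi (0:ℝ), (1 - Real.cos (x * h) - x * h * Real.sin (x * h)) * ((1 + h ^ 2) ^ (3 / 2 : ℝ))⁻¹
      = ∫ h in Ioi (0:ℝ), ∫ t in Ioi (0:ℝ), (fun p : ℝ × ℝ => (1 - Real.cos (x * p.1) - x * p.1 * Real.sin (x * p.1))
    * ((Real.Gamma (3 / 2))⁻¹ * (p.2 ^ (1 / 2 : ℝ) * Real.exp (-((1 + p.1 ^ 2) * p.2))))) (h, t) := by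
    refine integral_congr_ae (Filter.Eventually.of_forall fun h => ?_)
    simp only []
    rw [integral_const_mul, integral_const_mul, inv_rpow_three_halves_eq_integral h]
  -- swap
  have hint : Integrable (Function.uncurry fun h t => (fun p : ℝ × ℝ => (1 - Real.cos (x * p.1) - x * p.1 * Real.sin (x * p.1))
    * ((Real.Gamma (3 / 2))⁻¹ * (p.2 ^ (1 / 2 : ℝ) * Real.exp (-((1 + p.1 ^ 2) * p.2))))) (h, t))
      ((volume.restrict (Ioi (0:ℝ))).prod (volume.restrict (Ioi (0:ℝ)))) := integrable_subordinand x
  have hswap := integral_integral_swap hint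
  rw [hL, hswap]
  -- evaluate the inner `h`-integral for `t > 0`
  refine setIntegral_congr_fun measurableSet_Ioi (fun t ht => ?_)
  have ht : 0 < t := ht
  have hpt : ∀ h : ℝ, (fun p : ℝ × ℝ => (1 - Real.cos (x * p.1) - x * p.1 * Real.sin (x * p.1))
    * ((Real.Gamma (3 / 2))⁻¹ * (p.2 ^ (1 / 2 : ℝ) * Real.exp (-((1 + p.1 ^ 2) * p.2))))) (h, t) = ((Real.Gamma (3 / 2))⁻¹ * t ^ (1 / 2 : ℝ) * Real.exp (-t))
      * ((1 - Real.cos (x * h) - x * h * Real.sin (x * h)) * Real.exp (-t * h ^ 2)) := by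
    intro h
    simp only []
    have : Real.exp (-((1 + h ^ 2) * t)) = Real.exp (-t) * Real.exp (-t * h ^ 2) := by
      rw [← Real.exp_add]; congr 1; ring
    rw [this]; ring
  simp_rw [hpt]
  rw [integral_const_mul, integral_Ioi_liaIntegrand_mul_exp ht x, Gamma_three_halves,
    Real.sqrt_div Real.pi_pos.le, ← Real.sqrt_eq_rpow]
  have h1 : √t ≠ 0 := (Real.sqrt_pos.mpr ht).ne'
  have h2 : √π ≠ 0 := (Real.sqrt_pos.mpr Real.pi_pos).ne'
  field_simp

end Summit.NavierStokesRegularity.NavierStokesRegularity.Theorems.AnalyticStripLiaSymbol
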